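import Summits.AtomisticToContinuum.HydrodynamicLimit.Theses.WarmColdDichotomy
import Summits.AtomisticToContinuum.HydrodynamicLimit.Theorems.OneFlightGossipEngineEnergyCurrentTailsLevelCensusClosureTools
import Summits.AtomisticToContinuum.HydrodynamicLimit.Theorems.OneFlightGossipEngineEnergyCurrentTailsQuarticDocking
import Literature.MathematicalPhysics.KineticTheory.HardSphereEulerProofs
import HarnessLib

/-!
# Line `level-census-comparison` (crux `EnergyCurrentTails`, stmt-AtomisticToContinuum-9235):
# the census TRANSFER (registered stub `stub_censusTransfer`) and the Chebyshev docking

Support file (`--supports stmt-AtomisticToContinuum-9235`) of the line lead (seat c2), over the landed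
vocabulary `…Theorems.EnergyCurrentTailsLevelCensus` (`levelCensus`, `GaussianCensusBound`,
`QuarticMomentBound`).  It lands the two PROVED links at the top of the line's composition
`CensusLedger → RateCeiling → MergeCeiling → SplitFloor → GaussianCensusBound → QuarticMomentBound → crux`:

* `stub_censusTransfer : GaussianCensusBound → QuarticMomentBound` (registered stub T) — layer cake:
  `E‖V‖⁴ = 2∫₀^∞ P{τ < ‖V‖²} τ dτ` per particle (`lintegral_rpow_eq_lintegral_meas_lt_mul`), census
  `≤ N + 1` on `(0, max(E₀,1)]`, `τe^{−ατ} ≤ (2/α)e^{−ατ/2}` and `integral_exp_mul_Ioi` beyond; constant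
  `C = 2(max(E₀,1)² + 4B⁺/α²)`;
* `quarticDocking : QuarticMomentBound → …Theses.WarmColdDichotomy.EnergyCurrentTails` — the landed
  Chebyshev docking `…Theorems.LoschmidtTagging.stub_quarticDocking` (p92098) concludes the byte-identical
  `OneFlightGossipEngine` copy of the crux; the two route decls are definitionally equal, so the same term
  proves the primary copy (`quarticDocking`) — whence `energyCurrentTails_of_gaussianCensusBound` for both
  route decls.

Proofs of §1 copied from the registered skeleton `Cruxes/EnergyCurrentTails/Lines/level_census_comparison.lean`
§4 (planner `planner-cruxplan-stmt-AtomisticToContinuum-9235-level-census-compari-0`), re-homed on the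
landed objects (`levelCensus_le_card` is the landed `…LevelCensusClosureTools` one).  References:
Nachtergaele–Yau 2003 §2.3 (cut-off II.1); elementary measure theory.
-/

noncomputable section

open MeasureTheory Set Filter
open scoped ENNReal InnerProductSpace

namespace Summit.AtomisticToContinuum.HydrodynamicLimit.Theorems.EnergyCurrentTailsLevelCensus

open Literature.MathematicalPhysics.KineticTheory Literature.Analysis.FluidPDE

/-! ## §1 The transfer (registered stub T): `GaussianCensusBound → QuarticMomentBound` -/

/-- Layer-cake for the quartic moment of ONE particle, in census form:
`E‖V‖⁴ = 2 ∫₀^∞ P{τ < ‖V‖²} τ dτ` for a measurable `V`. -/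
theorem lintegral_norm_pow_four_eq {Ω : Type*} [MeasurableSpace Ω] (μ : Measure Ω) {V : Ω → V3}
    (hV : Measurable V) :
    ∫⁻ ω, ENNReal.ofReal (‖V ω‖ ^ 4) ∂μ
      = ENNReal.ofReal 2 * ∫⁻ τ in Set.Ioi 0,
          (∫⁻ ω, Set.indicator {v : V3 | τ < ‖v‖ ^ 2} (fun _ => (1 : ℝ≥0∞)) (V ω) ∂μ) * ENNReal.ofReal τ := by
  have hf : Measurable fun ω => ‖V ω‖ ^ 2 := (hV.norm).pow_const 2
  have hnn : 0 ≤ᵐ[μ] fun ω => ‖V ω‖ ^ 2 := Filter.Eventually.of_forall fun ω => by positivity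
  have key := lintegral_rpow_eq_lintegral_meas_lt_mul μ hnn hf.aemeasurable (p := 2) (by norm_num)
  have h4 : ∀ ω, ENNReal.ofReal ((‖V ω‖ ^ 2) ^ (2 : ℝ)) = ENNReal.ofReal (‖V ω‖ ^ 4) := by
    intro ω
    rw [Real.rpow_two]
    ring_nf
  simp_rw [h4] at key
  rw [key]
  congr 1
  refine setLIntegral_congr_fun measurableSet_Ioi fun τ _ => ?_
  have h1 : ENNReal.ofReal (τ ^ ((2 : ℝ) - 1)) = ENNReal.ofReal τ := by norm_num
  rw [h1]
  congr 1
  -- `μ {τ < ‖V‖²}` as the integral of an indicator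
  have hS : MeasurableSet {ω | τ < ‖V ω‖ ^ 2} := measurableSet_lt measurable_const hf
  rw [← lintegral_indicator_one hS]
  refine lintegral_congr fun ω => ?_
  by_cases h : τ < ‖V ω‖ ^ 2
  · rw [Set.indicator_of_mem (show V ω ∈ {v : V3 | τ < ‖v‖ ^ 2} from h),
      Set.indicator_of_mem (show ω ∈ {ω | τ < ‖V ω‖ ^ 2} from h), Pi.one_apply]
  · rw [Set.indicator_of_notMem (show V ω ∉ {v : V3 | τ < ‖v‖ ^ 2} from h),
      Set.indicator_of_notMem (show ω ∉ {ω | τ < ‖V ω‖ ^ 2} from h)]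

/-- The elementary tail estimate behind the transfer: `τ e^{−ατ} ≤ (2/α) e^{−ατ/2}` (all real `τ`). -/
theorem mul_exp_neg_le {α τ : ℝ} (hα : 0 < α) :
    τ * Real.exp (-α * τ) ≤ 2 / α * Real.exp (-(α / 2) * τ) := by
  have h1 : α * τ / 2 + 1 ≤ Real.exp (α * τ / 2) := Real.add_one_le_exp _
  have h2 : τ ≤ 2 / α * Real.exp (α * τ / 2) := by
    rw [div_mul_eq_mul_div, le_div_iff₀ hα]
    nlinarith [Real.exp_pos (α * τ / 2)]
  have h3 : Real.exp (-α * τ) = Real.exp (-(α / 2) * τ) * Real.exp (-(α / 2) * τ) := by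
    rw [← Real.exp_add]; ring_nf
  have h4 : Real.exp (α * τ / 2) * Real.exp (-(α / 2) * τ) = 1 := by
    rw [← Real.exp_add]; ring_nf; simp
  calc τ * Real.exp (-α * τ)
      ≤ (2 / α * Real.exp (α * τ / 2)) * Real.exp (-α * τ) :=
        mul_le_mul_of_nonneg_right h2 (Real.exp_pos _).le
    _ = 2 / α * Real.exp (-(α / 2) * τ) * (Real.exp (α * τ / 2) * Real.exp (-(α / 2) * τ)) := by
        rw [h3]; ring
    _ = 2 / α * Real.exp (-(α / 2) * τ) := by rw [h4, mul_one]

/-- The integral of the census majorant: if `g ≤ N+1` on `(0, E₁]` and `g τ ≤ B(N+1)e^{−ατ}` for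
`τ > E₁` (`E₁ ≥ 1`, `B ≥ 0`), then `∫₀^∞ g(τ) τ dτ ≤ (N+1)(E₁² + 4B/α²)`. -/
theorem lintegral_census_majorant_le {g : ℝ → ℝ≥0∞} {α B E₁ : ℝ} {N : ℕ} (hα : 0 < α) (hB : 0 ≤ B)
    (hE₁ : 1 ≤ E₁) (hg1 : ∀ τ, 0 < τ → g τ ≤ ((N + 1 : ℕ) : ℝ≥0∞))
    (hg2 : ∀ τ, E₁ < τ → g τ ≤ ENNReal.ofReal (B * ((N : ℝ) + 1) * Real.exp (-α * τ))) :
    ∫⁻ τ in Set.Ioi 0, g τ * ENNReal.ofReal τ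
      ≤ ENNReal.ofReal (((N : ℝ) + 1) * (E₁ ^ 2 + 4 * B / α ^ 2)) := by
  have hE₁0 : 0 < E₁ := by linarith
  -- split `(0, ∞) ⊆ (0, E₁] ∪ (E₁, ∞)`
  have hsplit : Set.Ioi (0 : ℝ) ⊆ Set.Ioc 0 E₁ ∪ Set.Ioi E₁ := by
    intro τ hτ
    by_cases h : τ ≤ E₁
    · exact Or.inl ⟨hτ, h⟩
    · exact Or.inr (not_le.1 h)
  have hN : ((N + 1 : ℕ) : ℝ≥0∞) = ENNReal.ofReal ((N : ℝ) + 1) := by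
    rw [show ((N : ℝ) + 1) = ((N + 1 : ℕ) : ℝ) by push_cast; ring, ENNReal.ofReal_natCast]
  -- the bounded part
  have hA : ∫⁻ τ in Set.Ioc 0 E₁, g τ * ENNReal.ofReal τ
      ≤ ENNReal.ofReal (((N : ℝ) + 1) * E₁ ^ 2) := by
    calc ∫⁻ τ in Set.Ioc 0 E₁, g τ * ENNReal.ofReal τ
        ≤ ∫⁻ _τ in Set.Ioc 0 E₁, ENNReal.ofReal (((N : ℝ) + 1) * E₁) := by
          refine setLIntegral_mono measurable_const fun τ hτ => ?_
          rw [ENNReal.ofReal_mul (by positivity), ← hN]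
          exact mul_le_mul' (hg1 τ hτ.1) (ENNReal.ofReal_le_ofReal hτ.2)
      _ = ENNReal.ofReal (((N : ℝ) + 1) * E₁) * volume (Set.Ioc 0 E₁) := setLIntegral_const _ _
      _ = ENNReal.ofReal (((N : ℝ) + 1) * E₁ ^ 2) := by
          rw [Real.volume_Ioc, sub_zero, ← ENNReal.ofReal_mul (by positivity)]
          ring_nf
  -- the tail part
  have hK : 0 ≤ 2 * B * ((N : ℝ) + 1) / α := by positivity
  have htail_pt : ∀ τ ∈ Set.Ioi E₁, g τ * ENNReal.ofReal τ
      ≤ ENNReal.ofReal (2 * B * ((N : ℝ) + 1) / α * Real.exp (-(α / 2) * τ)) := by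
    intro τ hτ
    calc g τ * ENNReal.ofReal τ
        ≤ ENNReal.ofReal (B * ((N : ℝ) + 1) * Real.exp (-α * τ)) * ENNReal.ofReal τ :=
          mul_le_mul' (hg2 τ hτ) le_rfl
      _ = ENNReal.ofReal (B * ((N : ℝ) + 1) * (τ * Real.exp (-α * τ))) := by
          rw [← ENNReal.ofReal_mul (by positivity)]; ring_nf
      _ ≤ ENNReal.ofReal (B * ((N : ℝ) + 1) * (2 / α * Real.exp (-(α / 2) * τ))) :=
          ENNReal.ofReal_le_ofReal
            (mul_le_mul_of_nonneg_left (mul_exp_neg_le hα) (by positivity))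
      _ = ENNReal.ofReal (2 * B * ((N : ℝ) + 1) / α * Real.exp (-(α / 2) * τ)) := by ring_nf
  have hint : IntegrableOn (fun τ => 2 * B * ((N : ℝ) + 1) / α * Real.exp (-(α / 2) * τ))
      (Set.Ioi E₁) := (exp_neg_integrableOn_Ioi E₁ (half_pos hα)).const_mul _
  have hBtail : ∫⁻ τ in Set.Ioi E₁, g τ * ENNReal.ofReal τ
      ≤ ENNReal.ofReal (((N : ℝ) + 1) * (4 * B / α ^ 2)) := by
    calc ∫⁻ τ in Set.Ioi E₁, g τ * ENNReal.ofReal τ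
        ≤ ∫⁻ τ in Set.Ioi E₁,
            ENNReal.ofReal (2 * B * ((N : ℝ) + 1) / α * Real.exp (-(α / 2) * τ)) :=
          setLIntegral_mono' measurableSet_Ioi htail_pt
      _ = ENNReal.ofReal (∫ τ in Set.Ioi E₁, 2 * B * ((N : ℝ) + 1) / α * Real.exp (-(α / 2) * τ)) := by
          rw [ofReal_integral_eq_lintegral_ofReal hint]
          exact Filter.Eventually.of_forall fun τ => by positivity
      _ ≤ ENNReal.ofReal (((N : ℝ) + 1) * (4 * B / α ^ 2)) := by
          apply ENNReal.ofReal_le_ofReal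
          rw [integral_const_mul]
          have hI : ∫ τ in Set.Ioi E₁, Real.exp (-(α / 2) * τ)
              = -Real.exp (-(α / 2) * E₁) / (-(α / 2)) :=
            integral_exp_mul_Ioi (by linarith) E₁
          rw [hI]
          have hexp : Real.exp (-(α / 2) * E₁) ≤ 1 := by
            rw [Real.exp_le_one_iff]; nlinarith
          have hpos : 0 < Real.exp (-(α / 2) * E₁) := Real.exp_pos _
          have h1 : -Real.exp (-(α / 2) * E₁) / (-(α / 2)) = 2 / α * Real.exp (-(α / 2) * E₁) := by
            field_simp
          rw [h1]
          have h2 : 2 * B * ((N : ℝ) + 1) / α * (2 / α * Real.exp (-(α / 2) * E₁))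
              = ((N : ℝ) + 1) * (4 * B / α ^ 2) * Real.exp (-(α / 2) * E₁) := by
            field_simp; ring
          rw [h2]
          have h3 : 0 ≤ ((N : ℝ) + 1) * (4 * B / α ^ 2) := by positivity
          nlinarith
  calc ∫⁻ τ in Set.Ioi 0, g τ * ENNReal.ofReal τ
      ≤ ∫⁻ τ in Set.Ioc 0 E₁ ∪ Set.Ioi E₁, g τ * ENNReal.ofReal τ := lintegral_mono_set hsplit
    _ ≤ (∫⁻ τ in Set.Ioc 0 E₁, g τ * ENNReal.ofReal τ) + ∫⁻ τ in Set.Ioi E₁, g τ * ENNReal.ofReal τ :=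
        lintegral_union_le _ _ _
    _ ≤ ENNReal.ofReal (((N : ℝ) + 1) * E₁ ^ 2) + ENNReal.ofReal (((N : ℝ) + 1) * (4 * B / α ^ 2)) :=
        add_le_add hA hBtail
    _ = ENNReal.ofReal (((N : ℝ) + 1) * (E₁ ^ 2 + 4 * B / α ^ 2)) := by
        rw [← ENNReal.ofReal_add (by positivity) (by positivity)]; ring_nf

/-- **Registered stub T — THE CENSUS TRANSFER**: the Gaussian census bound gives an `N`-uniform quartic
moment along the true flow (layer cake; constant `C = 2(max(E₀,1)² + 4 max(B,0)/α²)`). -/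
theorem stub_censusTransfer : GaussianCensusBound → QuarticMomentBound := by
  intro hG a₀ θ₀ u₀ ha hθ hu ha0 hθ0
  obtain ⟨σ₀, hσ₀, H⟩ := hG a₀ θ₀ u₀ ha hθ hu ha0 hθ0
  refine ⟨min σ₀ (1 / 2), lt_min hσ₀ (by norm_num), ?_⟩
  intro σ hσ hσlt T ρ θ u hE Φ h0 t ht
  have hσ₁ : σ < σ₀ := lt_of_lt_of_le hσlt (min_le_left _ _)
  have hσ2 : σ ≤ 1 / 2 := (lt_of_lt_of_le hσlt (min_le_right _ _)).le
  obtain ⟨α, hα, B, E₀, N₀, HN⟩ := H σ hσ hσ₁ T ρ θ u hE Φ h0 t ht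
  set E₁ : ℝ := max E₀ 1 with hE₁
  set B' : ℝ := max B 0 with hB'
  have hE₁1 : 1 ≤ E₁ := le_max_right _ _
  have hB'0 : 0 ≤ B' := le_max_right _ _
  refine ⟨2 * (E₁ ^ 2 + 4 * B' / α ^ 2), N₀, fun N hN s hs => ?_⟩
  haveI : IsProbabilityMeasure (localGibbsLaw σ a₀ u₀ θ₀ N (Φ N)) :=
    isProbabilityMeasure_localGibbsLaw ha hθ hu ha0 hθ0 hσ2 N (Φ N)
  -- the census majorant at time `s`
  have hg1 : ∀ τ : ℝ, 0 < τ → levelCensus σ a₀ θ₀ u₀ N (Φ N) s τ ≤ ((N + 1 : ℕ) : ℝ≥0∞) :=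
    fun τ _ => levelCensus_le_card (Φ N) s τ
  have hg2 : ∀ τ : ℝ, E₁ < τ → levelCensus σ a₀ θ₀ u₀ N (Φ N) s τ
      ≤ ENNReal.ofReal (B' * ((N : ℝ) + 1) * Real.exp (-α * τ)) := by
    intro τ hτ
    have hτ' : E₀ ≤ τ := ((le_max_left _ _).trans hτ.le)
    refine (HN N hN s hs τ hτ').trans (ENNReal.ofReal_le_ofReal ?_)
    exact mul_le_mul_of_nonneg_right (mul_le_mul_of_nonneg_right (le_max_left _ _)
      (by positivity)) (Real.exp_pos _).le
  have hmaj := lintegral_census_majorant_le (g := fun τ => levelCensus σ a₀ θ₀ u₀ N (Φ N) s τ)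
    hα hB'0 hE₁1 hg1 hg2
  -- per-particle layer cake, summed
  have hvel : ∀ i : Fin (N + 1), Measurable fun z : Config (N + 1) (Fin 3) T3 => ((Φ N).flow s z i).2 :=
    fun i => measurable_snd.comp ((measurable_pi_apply i).comp ((Φ N).measurable_flow s))
  have hsum : ∑ i : Fin (N + 1), ∫⁻ z, ENNReal.ofReal (‖((Φ N).flow s z i).2‖ ^ 4)
        ∂(localGibbsLaw σ a₀ u₀ θ₀ N (Φ N))
      = ENNReal.ofReal 2 * ∫⁻ τ in Set.Ioi 0,
          levelCensus σ a₀ θ₀ u₀ N (Φ N) s τ * ENNReal.ofReal τ := by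
    have hi : ∀ i : Fin (N + 1), ∫⁻ z, ENNReal.ofReal (‖((Φ N).flow s z i).2‖ ^ 4)
          ∂(localGibbsLaw σ a₀ u₀ θ₀ N (Φ N))
        = ENNReal.ofReal 2 * ∫⁻ τ in Set.Ioi 0,
            (∫⁻ z, Set.indicator {v : V3 | τ < ‖v‖ ^ 2} (fun _ => (1 : ℝ≥0∞)) (((Φ N).flow s z i).2)
              ∂(localGibbsLaw σ a₀ u₀ θ₀ N (Φ N))) * ENNReal.ofReal τ :=
      fun i => lintegral_norm_pow_four_eq _ (hvel i)
    simp_rw [hi]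
    rw [← Finset.mul_sum]
    congr 1
    -- swap the finite sum and the `τ`-integral
    have hmeas : ∀ i : Fin (N + 1), Measurable fun τ : ℝ =>
        (∫⁻ z, Set.indicator {v : V3 | τ < ‖v‖ ^ 2} (fun _ => (1 : ℝ≥0∞)) (((Φ N).flow s z i).2)
          ∂(localGibbsLaw σ a₀ u₀ θ₀ N (Φ N))) * ENNReal.ofReal τ := by
      intro i
      refine Measurable.mul ?_ ENNReal.measurable_ofReal
      refine Antitone.measurable fun τ₁ τ₂ hτ => ?_
      refine lintegral_mono fun z => ?_
      refine Set.indicator_le_indicator_of_subset (fun v hv => ?_) (fun _ => zero_le_one) _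
      exact lt_of_le_of_lt hτ hv
    rw [← lintegral_finsetSum _ fun i _ => hmeas i]
    refine setLIntegral_congr_fun measurableSet_Ioi fun τ _ => ?_
    rw [← Finset.sum_mul]
    congr 1
    unfold levelCensus
    rw [lintegral_finsetSum _ fun i _ => ?_]
    exact (measurable_const.indicator (measurableSet_lt measurable_const
      ((measurable_norm.pow_const 2)))).comp (hvel i)
  -- assemble
  have hpt : ∀ z : Config (N + 1) (Fin 3) T3,
      ENNReal.ofReal (((N : ℝ) + 1)⁻¹ * ∑ i : Fin (N + 1), ‖((Φ N).flow s z i).2‖ ^ 4) =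
        ENNReal.ofReal (((N : ℝ) + 1)⁻¹) *
          ∑ i : Fin (N + 1), ENNReal.ofReal (‖((Φ N).flow s z i).2‖ ^ 4) := by
    intro z
    rw [ENNReal.ofReal_mul (by positivity), ENNReal.ofReal_sum_of_nonneg fun i _ => by positivity]
  have hvel4 : ∀ i : Fin (N + 1), Measurable fun z : Config (N + 1) (Fin 3) T3 =>
      ENNReal.ofReal (‖((Φ N).flow s z i).2‖ ^ 4) := fun i =>
    ((measurable_norm.pow_const 4).ennreal_ofReal).comp (hvel i)
  calc ∫⁻ z, ENNReal.ofReal (((N : ℝ) + 1)⁻¹ * ∑ i : Fin (N + 1), ‖((Φ N).flow s z i).2‖ ^ 4)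
        ∂(localGibbsLaw σ a₀ u₀ θ₀ N (Φ N))
      = ∫⁻ z, ENNReal.ofReal (((N : ℝ) + 1)⁻¹) *
          ∑ i : Fin (N + 1), ENNReal.ofReal (‖((Φ N).flow s z i).2‖ ^ 4)
          ∂(localGibbsLaw σ a₀ u₀ θ₀ N (Φ N)) := lintegral_congr fun z => hpt z
    _ = ENNReal.ofReal (((N : ℝ) + 1)⁻¹) *
          ∫⁻ z, ∑ i : Fin (N + 1), ENNReal.ofReal (‖((Φ N).flow s z i).2‖ ^ 4)
            ∂(localGibbsLaw σ a₀ u₀ θ₀ N (Φ N)) :=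
        lintegral_const_mul _ (Finset.measurable_sum _ fun i _ => hvel4 i)
    _ = ENNReal.ofReal (((N : ℝ) + 1)⁻¹) *
          ∑ i : Fin (N + 1), ∫⁻ z, ENNReal.ofReal (‖((Φ N).flow s z i).2‖ ^ 4)
            ∂(localGibbsLaw σ a₀ u₀ θ₀ N (Φ N)) := by
        congr 1
        exact lintegral_finsetSum _ fun i _ => hvel4 i
    _ = ENNReal.ofReal (((N : ℝ) + 1)⁻¹) * (ENNReal.ofReal 2 * ∫⁻ τ in Set.Ioi 0,
          levelCensus σ a₀ θ₀ u₀ N (Φ N) s τ * ENNReal.ofReal τ) := by rw [hsum]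
    _ ≤ ENNReal.ofReal (((N : ℝ) + 1)⁻¹) * (ENNReal.ofReal 2 *
          ENNReal.ofReal (((N : ℝ) + 1) * (E₁ ^ 2 + 4 * B' / α ^ 2))) := by
        gcongr
    _ = ENNReal.ofReal (2 * (E₁ ^ 2 + 4 * B' / α ^ 2)) := by
        rw [← ENNReal.ofReal_mul (by norm_num), ← ENNReal.ofReal_mul (by positivity)]
        congr 1
        field_simp

/-! ## §2 The Chebyshev docking (landed `stub_quarticDocking`, p92098) and the top composition -/

/-- **Chebyshev docking for the primary decl**: an `N`-uniform quartic moment along the true flow implies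
`WarmColdDichotomy.EnergyCurrentTails` — the landed `…Theorems.LoschmidtTagging.stub_quarticDocking`
proves the `OneFlightGossipEngine` copy, which is the same `Prop` by `rfl` of the two route definitions. -/
theorem quarticDocking (hQ : QuarticMomentBound) :
    Summit.AtomisticToContinuum.HydrodynamicLimit.Theses.WarmColdDichotomy.EnergyCurrentTails :=
  Summit.AtomisticToContinuum.HydrodynamicLimit.Theorems.LoschmidtTagging.stub_quarticDocking hQ

/-- The same docking, concluding the `OneFlightGossipEngine` copy of the crux (payload route of the line). -/
theorem quarticDocking_oneFlight (hQ : QuarticMomentBound) :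
    Summit.AtomisticToContinuum.HydrodynamicLimit.Theses.OneFlightGossipEngine.EnergyCurrentTails :=
  Summit.AtomisticToContinuum.HydrodynamicLimit.Theorems.LoschmidtTagging.stub_quarticDocking hQ

/-- **The line's top composition, landed**: the Gaussian census bound C⁺ implies the crux
`WarmColdDichotomy.EnergyCurrentTails` BY NAME (transfer + Chebyshev docking). -/
theorem energyCurrentTails_of_gaussianCensusBound (hG : GaussianCensusBound) :
    Summit.AtomisticToContinuum.HydrodynamicLimit.Theses.WarmColdDichotomy.EnergyCurrentTails :=
  quarticDocking (stub_censusTransfer hG)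

/-- The top composition for the `OneFlightGossipEngine` copy of the crux. -/
theorem energyCurrentTails_oneFlight_of_gaussianCensusBound (hG : GaussianCensusBound) :
    Summit.AtomisticToContinuum.HydrodynamicLimit.Theses.OneFlightGossipEngine.EnergyCurrentTails :=
  quarticDocking_oneFlight (stub_censusTransfer hG)

end Summit.AtomisticToContinuum.HydrodynamicLimit.Theorems.EnergyCurrentTailsLevelCensus

end
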